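import Summits.QuantumFields.BalabanUV.Beta.GAN24.StripAliasBounds

/-!
# `BalabanUV.Beta.GAN24.StripAliasWeights` — binder row G-an2-4 / (CONV-C), road P1-fibre, self-row **Y10g\*** part 3 (input of p1's
# leaf L10 `FibreStrip`, nodes N15k/N15u): THE GEOMETRIC ALIAS WEIGHTS ON THE STRIP obey the real-zone `sinWt` majorants of leaf P1-L06 up
# to the factor `6` per geometric sum, for EVERY alias, UNIFORMLY IN `N`

NOT IN PRINT; OUR PROOF ATTEMPT.  HONEST FRAMING (cell contract, verbatim): «discharging `BetaPertH` makes Bałaban's UV stability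
UNCONDITIONAL — a real constructive-QFT result; it is NOT the continuum limit and NOT the Clay problem.»  HONEST DEPENDENCY (verbatim):
«continuum YM on T⁴ ⇐ BetaPertH ∧ nine spine estimates (0/9 proved); BetaPertH ⇐ (D1) ∧ (D4) ∧ CAP+tail; G-an2-4 gates asym, D1 and
NE2/3/4.»  [folklore] bookkeeping estimates; NO cited fact, NO `def … : Prop` hypothesis, NO wall binder, NO new object.  NOT summit
progress; nothing of (CONV-C)'s K-slot is discharged here.

## The mechanism (one geometric sum `G(z, n) = Σ_{t<n} e^{izt}` = `AliasObjects.gs z n`, `z = x + iε`, `|ε|·n ≤ η ≤ 1/4`)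
Regime split on the real-zone weight `sinWt n x = 1/max(1, (n sin(x/2))²)`: if `n|sin(x/2)| ≤ 1` the termwise bound
`‖G‖ ≤ n·e^{η}` (leaf P1-L06 `norm_geomExp_le_of_im`) is already `≤ (1 + e^η)·n`; if `n|sin(x/2)| > 1` then `G·(e^{iz} − 1) = e^{izn} − 1`
(`geomExp_mul_sub_one`), `‖e^{izn} − 1‖ ≤ e^{η} + 1` and `‖e^{iz} − 1‖ ≥ 2e^{−|ε|}|sin(x/2)| − ‖e^{−ε} − 1‖ ≥ (2e^{−η} − 2η)·|sin(x/2)| ≥ |sin(x/2)|`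
(because `|ε| ≤ η/n < η|sin(x/2)|` in this regime and `2e^{−η} − 2η ≥ 1` for `η ≤ 1/4`), so `‖G‖ ≤ (1 + e^η)/|sin(x/2)|`.  Either way
`‖G(z,n)‖² ≤ (1 + e^η)²·n²·sinWt n x ≤ 6·n²·sinWt n x` (`e^{1/4} ≤ 1 + 1/4 + 1/16`).

## What is proved (general `D`, `N ≥ 1`; complex `p` with `him : ∀ i, |(p i).im| ≤ η`, `0 ≤ η ≤ 1/4`; `x := kfine N (reVec p) m` REAL)
* §1 `exp_quarter_le`, `two_exp_neg_sub_ge_one` (`1 ≤ 2e^{−η} − 2η`), `norm_cexp_I_mul_nat_le` (`‖e^{izn}‖ ≤ e^{η}`),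
  `norm_cexp_I_sub_one_ge` (`|sin(x/2)| ≤ ‖e^{iz} − 1‖` in the second regime), **`norm_gs_sq_le_of_im`** (`‖gs z n‖² ≤ 6·n²·sinWt n (re z)`).
* §2 INSTANCES for the objects of `GAN24/AliasObjects` (every alias `m`, `M ≤ N` for the `M`-level weights):
  `norm_sAl_sq_le_strip`, `norm_sbAl_sq_le_strip` (`≤ 6·N²·sinWt N x_κ`), `norm_sMAl_sq_le_strip`, `norm_sbMAl_sq_le_strip` (`≤ 6·M²·sinWt M x_κ`),
  `norm_SAl_sq_le_strip`, `norm_SbAl_sq_le_strip` (`≤ (6N²)^D·Π_i sinWt N x_i`), `norm_SMAl_sq_le_strip`, `norm_SbMAl_sq_le_strip`,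
  `norm_SAl_mul_sAl_sq_le_strip` (the Q-row/leg weight `S·s_κ`), `norm_chiAl_sq_le_strip` (`‖χ̂(m)‖² ≤ 6^D·Π sinWt ≤ 6^D`),
  and the offset phase `norm_cexp_offset_strip` (`‖e^{i k_m·Mρ}‖ = exp(−(M/N)·Σ_i Im(p_i)ρ_i) ≤ exp(η·Σ_i |ρ_i|)`, every `M ≤ N`).
Unit `b2b-balaban-gan24-formalise-leaf-18` (G-an2-4 formalisation swarm), 2026-08-20.
-/

noncomputable section

open Complex Finset
open scoped BigOperators Real
open Literature.Probability.LatticeModels (TorusSite)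
open Literature.MathematicalPhysics.QuantumFieldTheory
open Literature.MathematicalPhysics.QuantumFieldTheory.Balaban1983to89
open B4Strip (ofRealVec reVec)
open Summit.QuantumFields.BalabanUV.Beta.GAN24.AliasWeights (sinWt sinWt_pos sinWt_le_one kfine norm_geomExp_le_of_im geomExp_mul_sub_one
  cexp_I_mul_mul_nat)
open Summit.QuantumFields.BalabanUV.Beta.GAN24.AliasObjects (kAl gs sAl SAl sbAl SbAl chiAl sMAl SMAl sbMAl SbMAl)
open Summit.QuantumFields.BalabanUV.Beta.GAN24.ReadingWeightSums (sinWt_neg)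
open Summit.QuantumFields.BalabanUV.Beta.GAN24.StripAliasBounds (kAl_eq_kfine_add kAl_re_im abs_im_div_le cexp_I_mul_add
  norm_cexp_neg_ofReal_sub_one_le norm_cexp_I_mul_sub_one)

namespace Summit.QuantumFields.BalabanUV.Beta.GAN24.StripAliasWeights

variable {D : ℕ} {N : ℕ} [NeZero N]

/-! ## §1 One geometric sum on a horizontal line -/

/-- [folklore] `e^{η} ≤ 1 + η + η²` for `0 ≤ η ≤ 1` (Mathlib `Real.abs_exp_sub_one_sub_id_le`). -/
theorem exp_le_one_add_add_sq {η : ℝ} (hη : 0 ≤ η) (hη1 : η ≤ 1) : Real.exp η ≤ 1 + η + η ^ 2 := by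
  have h := Real.abs_exp_sub_one_sub_id_le (x := η) (by rw [abs_of_nonneg hη]; exact hη1)
  have := le_abs_self (Real.exp η - 1 - η)
  linarith

/-- [folklore] `(1 + e^{η})² ≤ 6` for `0 ≤ η ≤ 1/4`. -/
theorem one_add_exp_sq_le_six {η : ℝ} (hη : 0 ≤ η) (hη4 : η ≤ 1 / 4) : (1 + Real.exp η) ^ 2 ≤ 6 := by
  have h := exp_le_one_add_add_sq hη (by linarith)
  have h0 : 0 ≤ Real.exp η := (Real.exp_pos η).le
  have he : Real.exp η ≤ 21 / 16 := by nlinarith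
  have h1 : (1 + Real.exp η) ^ 2 ≤ (1 + 21 / 16) ^ 2 := pow_le_pow_left₀ (by positivity) (by linarith) 2
  norm_num at h1
  linarith

/-- [folklore] `1 ≤ 2e^{−η} − 2η` for `0 ≤ η ≤ 1/4` (from `e^{−η} ≥ 1 − η`). -/
theorem one_le_two_exp_neg_sub {η : ℝ} (hη4 : η ≤ 1 / 4) : 1 ≤ 2 * Real.exp (-η) - 2 * η := by
  have h := Real.add_one_le_exp (-η)
  linarith

/-- [folklore] `‖e^{izt}‖ ≤ e^{η}` for `t ≤ n` and `|Im z|·n ≤ η`. -/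
theorem norm_cexp_I_mul_mul_le {z : ℂ} {n : ℕ} {η : ℝ} (hz : |z.im| * n ≤ η) {t : ℕ} (ht : t ≤ n) :
    ‖cexp (I * z * t)‖ ≤ Real.exp η := by
  rw [AliasWeights.norm_cexp_I_mul_mul_nat]
  refine Real.exp_le_exp.2 ?_
  have ht' : (t : ℝ) ≤ n := by exact_mod_cast ht
  have h1 : -(z.im * t) ≤ |z.im| * t := by
    have := neg_abs_le z.im
    nlinarith [Nat.cast_nonneg (α := ℝ) t]
  have h2 : |z.im| * t ≤ |z.im| * n := mul_le_mul_of_nonneg_left ht' (abs_nonneg _)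
  linarith

/-- [folklore] LOWER BOUND FOR THE DENOMINATOR in the regime `n|sin(x/2)| > 1`: `|sin(x/2)| ≤ ‖e^{iz} − 1‖` for `z = x + iε`,
`|ε|·n ≤ η ≤ 1/4`, `1 < n|sin(x/2)|`. -/
theorem abs_sin_le_norm_cexp_sub_one {x ε η : ℝ} {n : ℕ} (hε : |ε| * n ≤ η) (hη : 0 ≤ η) (hη4 : η ≤ 1 / 4)
    (hreg : 1 < (n : ℝ) * |Real.sin (x / 2)|) :
    |Real.sin (x / 2)| ≤ ‖cexp (I * ((x : ℂ) + I * (ε : ℂ))) - 1‖ := by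
  set s := |Real.sin (x / 2)| with hs
  have hs0 : 0 ≤ s := abs_nonneg _
  have hn0 : (0 : ℝ) < n := by
    rcases (Nat.cast_nonneg (α := ℝ) n).eq_or_lt with h | h
    · rw [← h, zero_mul] at hreg; linarith
    · exact h
  -- `|ε| ≤ η/n < η·s`
  have hεs : |ε| ≤ η * s := by
    have h1 : |ε| * n ≤ η * 1 := by linarith
    have h2 : η * 1 ≤ η * ((n : ℝ) * s) := mul_le_mul_of_nonneg_left hreg.le hη
    nlinarith
  have hs1 : s ≤ 1 := Real.abs_sin_le_one _
  have hηs : η * s ≤ η := mul_le_of_le_one_right hη hs1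
  have hε1 : |ε| ≤ 1 := by linarith
  have hεη : ε ≤ η := (le_abs_self ε).trans (hεs.trans hηs)
  -- decomposition `e^{iz} − 1 = e^{−ε}(e^{ix} − 1) + (e^{−ε} − 1)`
  have hdec : cexp (I * ((x : ℂ) + I * (ε : ℂ))) - 1 = cexp (-(ε : ℂ)) * (cexp (I * (x : ℂ)) - 1) + (cexp (-(ε : ℂ)) - 1) := by
    rw [cexp_I_mul_add]; ring
  have hmain : ‖cexp (-(ε : ℂ)) * (cexp (I * (x : ℂ)) - 1)‖ = Real.exp (-ε) * (2 * s) := by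
    rw [norm_mul, norm_cexp_I_mul_sub_one, show (-(ε : ℂ)) = ((-ε : ℝ) : ℂ) by push_cast; ring, Complex.norm_exp_ofReal]
  have herr : ‖cexp (-(ε : ℂ)) - 1‖ ≤ 2 * |ε| := norm_cexp_neg_ofReal_sub_one_le hε1
  have hexp : Real.exp (-η) ≤ Real.exp (-ε) := Real.exp_le_exp.2 (by linarith)
  have hkey := one_le_two_exp_neg_sub hη4
  calc s = 1 * s := (one_mul s).symm
    _ ≤ (2 * Real.exp (-η) - 2 * η) * s := mul_le_mul_of_nonneg_right hkey hs0
    _ ≤ Real.exp (-ε) * (2 * s) - 2 * |ε| := by nlinarith [mul_le_mul_of_nonneg_right hexp hs0]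
    _ ≤ ‖cexp (-(ε : ℂ)) * (cexp (I * (x : ℂ)) - 1)‖ - ‖cexp (-(ε : ℂ)) - 1‖ := by rw [hmain]; linarith
    _ ≤ ‖cexp (-(ε : ℂ)) * (cexp (I * (x : ℂ)) - 1) + (cexp (-(ε : ℂ)) - 1)‖ := by
        have := norm_sub_norm_le (cexp (-(ε : ℂ)) * (cexp (I * (x : ℂ)) - 1)) (-(cexp (-(ε : ℂ)) - 1))
        rw [norm_neg, sub_neg_eq_add] at this
        exact this
    _ = ‖cexp (I * ((x : ℂ) + I * (ε : ℂ))) - 1‖ := by rw [hdec]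

/-- [folklore] **ONE GEOMETRIC SUM ON THE STRIP**: for `z = x + iε` with `|ε|·n ≤ η`, `0 ≤ η ≤ 1/4`:
`‖gs z n‖² ≤ 6·n²·sinWt n x` — the real-zone weight of leaf P1-L06 (`norm_geomExp_sq_le`) up to the factor `6`. -/
theorem norm_gs_sq_le_of_im (x ε : ℝ) (n : ℕ) {η : ℝ} (hε : |ε| * n ≤ η) (hη : 0 ≤ η) (hη4 : η ≤ 1 / 4) :
    ‖gs ((x : ℂ) + I * (ε : ℂ)) n‖ ^ 2 ≤ 6 * (n : ℝ) ^ 2 * sinWt n x := by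
  set z : ℂ := (x : ℂ) + I * (ε : ℂ) with hz
  have hzim : z.im = ε := by simp [hz]
  have hzn : |z.im| * n ≤ η := by rw [hzim]; exact hε
  have h6 := one_add_exp_sq_le_six hη hη4
  have hA0 : 0 ≤ ‖gs z n‖ := norm_nonneg _
  have hn0 : (0 : ℝ) ≤ n := Nat.cast_nonneg n
  -- termwise bound, valid everywhere
  have hterm : ‖gs z n‖ ≤ n * Real.exp η := by
    unfold gs
    exact norm_geomExp_le_of_im z n hzn
  have hexp1 : Real.exp η ≤ 1 + Real.exp η := by linarith
  unfold sinWt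
  rcases le_or_gt (((n : ℝ) * Real.sin (x / 2)) ^ 2) 1 with h | h
  · -- first regime: weight = 1
    rw [max_eq_left h, div_one, mul_one]
    have h1 : ‖gs z n‖ ≤ n * (1 + Real.exp η) := hterm.trans (mul_le_mul_of_nonneg_left hexp1 hn0)
    calc ‖gs z n‖ ^ 2 ≤ ((n : ℝ) * (1 + Real.exp η)) ^ 2 := pow_le_pow_left₀ hA0 h1 2
      _ = (1 + Real.exp η) ^ 2 * (n : ℝ) ^ 2 := by ring
      _ ≤ 6 * (n : ℝ) ^ 2 := mul_le_mul_of_nonneg_right h6 (sq_nonneg _)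
  · -- second regime: `n|sin(x/2)| > 1`
    rw [max_eq_right h.le]
    have hreg : 1 < (n : ℝ) * |Real.sin (x / 2)| := by
      have h' : 1 < ((n : ℝ) * |Real.sin (x / 2)|) ^ 2 := by rwa [mul_pow, sq_abs, ← mul_pow]
      nlinarith [mul_nonneg hn0 (abs_nonneg (Real.sin (x / 2)))]
    set s := |Real.sin (x / 2)| with hs
    have hs0 : 0 < s := pos_of_mul_pos_right (by linarith) hn0
    have hden : s ≤ ‖cexp (I * z) - 1‖ := abs_sin_le_norm_cexp_sub_one hε hη hη4 hreg
    have hnum : ‖cexp (I * z * n) - 1‖ ≤ 1 + Real.exp η := by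
      calc ‖cexp (I * z * n) - 1‖ ≤ ‖cexp (I * z * n)‖ + ‖(1 : ℂ)‖ := norm_sub_le _ _
        _ ≤ Real.exp η + 1 := by rw [norm_one]; exact add_le_add (norm_cexp_I_mul_mul_le hzn le_rfl) le_rfl
        _ = 1 + Real.exp η := by ring
    have hid : gs z n * (cexp (I * z) - 1) = cexp (I * z * n) - 1 := geomExp_mul_sub_one z n
    have hprod : ‖gs z n‖ * s ≤ 1 + Real.exp η := by
      calc ‖gs z n‖ * s ≤ ‖gs z n‖ * ‖cexp (I * z) - 1‖ := mul_le_mul_of_nonneg_left hden hA0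
        _ = ‖cexp (I * z * n) - 1‖ := by rw [← norm_mul, hid]
        _ ≤ 1 + Real.exp η := hnum
    have hA : ‖gs z n‖ ≤ (1 + Real.exp η) / s := by rw [le_div_iff₀ hs0]; exact hprod
    have hsq : s ^ 2 = Real.sin (x / 2) ^ 2 := sq_abs _
    calc ‖gs z n‖ ^ 2 ≤ ((1 + Real.exp η) / s) ^ 2 := pow_le_pow_left₀ hA0 hA 2
      _ = (1 + Real.exp η) ^ 2 * ((n : ℝ) ^ 2 * (1 / ((n : ℝ) * Real.sin (x / 2)) ^ 2)) := by
          have hn : (n : ℝ) ≠ 0 := by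
            intro h0; rw [h0, zero_mul] at hreg; linarith
          rw [div_pow, mul_pow, ← hsq]
          field_simp
      _ ≤ 6 * ((n : ℝ) ^ 2 * (1 / ((n : ℝ) * Real.sin (x / 2)) ^ 2)) := mul_le_mul_of_nonneg_right h6 (by positivity)
      _ = 6 * (n : ℝ) ^ 2 * (1 / ((n : ℝ) * Real.sin (x / 2)) ^ 2) := by ring

/-! ## §2 The weights of `GAN24/AliasObjects` on the strip -/

section Strip

variable {p : Fin D → ℂ} {η : ℝ}

/-- [folklore] The fine momentum of an alias, coordinate `κ`, as `x_κ + iε_κ` with `|ε_κ|·N ≤ η` on the strip. -/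
theorem abs_im_div_mul_le (him : ∀ i, |(p i).im| ≤ η) (κ : Fin D) {M : ℕ} (hMN : M ≤ N) : |(p κ).im / N| * M ≤ η := by
  have hN : (0 : ℝ) < N := by exact_mod_cast Nat.pos_of_ne_zero (NeZero.ne N)
  have hM : (M : ℝ) ≤ N := by exact_mod_cast hMN
  rw [abs_div, Nat.abs_cast]
  have h1 : |(p κ).im| / N * M ≤ |(p κ).im| / N * N := mul_le_mul_of_nonneg_left hM (by positivity)
  rw [div_mul_cancel₀ _ hN.ne'] at h1
  exact h1.trans (him κ)

/-- [folklore] **`‖s_κ(m)(p)‖² ≤ 6·N²·sinWt N x_κ`** on the strip (every alias `m`). -/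
theorem norm_sAl_sq_le_strip (him : ∀ i, |(p i).im| ≤ η) (hη : 0 ≤ η) (hη4 : η ≤ 1 / 4) (m : TorusSite D N) (κ : Fin D) :
    ‖sAl N p m κ‖ ^ 2 ≤ 6 * (N : ℝ) ^ 2 * sinWt N (kfine N (reVec p) m κ) := by
  unfold sAl
  rw [kAl_eq_kfine_add]
  exact norm_gs_sq_le_of_im _ _ N (abs_im_div_mul_le him κ le_rfl) hη hη4

/-- [folklore] **`‖s_{M,κ}(m)(p)‖² ≤ 6·M²·sinWt M x_κ`** on the strip, for every decimation side `M ≤ N`. -/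
theorem norm_sMAl_sq_le_strip (him : ∀ i, |(p i).im| ≤ η) (hη : 0 ≤ η) (hη4 : η ≤ 1 / 4) {M : ℕ} (hMN : M ≤ N)
    (m : TorusSite D N) (κ : Fin D) :
    ‖sMAl N M p m κ‖ ^ 2 ≤ 6 * (M : ℝ) ^ 2 * sinWt M (kfine N (reVec p) m κ) := by
  unfold sMAl
  rw [kAl_eq_kfine_add]
  exact norm_gs_sq_le_of_im _ _ M (abs_im_div_mul_le him κ hMN) hη hη4

/-- [folklore] The flat fine momentum: `−k_m(p)_κ = (−x_κ) + i(−ε_κ)`. -/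
theorem neg_kAl_eq (p : Fin D → ℂ) (m : TorusSite D N) (κ : Fin D) :
    -kAl N p m κ = (((-kfine N (reVec p) m κ : ℝ)) : ℂ) + I * (((-((p κ).im / N) : ℝ)) : ℂ) := by
  rw [kAl_eq_kfine_add]; push_cast; ring

/-- [folklore] **`‖s♭_κ(m)(p)‖² ≤ 6·N²·sinWt N x_κ`** (flat twin; `sinWt` is even). -/
theorem norm_sbAl_sq_le_strip (him : ∀ i, |(p i).im| ≤ η) (hη : 0 ≤ η) (hη4 : η ≤ 1 / 4) (m : TorusSite D N) (κ : Fin D) :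
    ‖sbAl N p m κ‖ ^ 2 ≤ 6 * (N : ℝ) ^ 2 * sinWt N (kfine N (reVec p) m κ) := by
  unfold sbAl
  rw [neg_kAl_eq, ← sinWt_neg]
  exact norm_gs_sq_le_of_im _ _ N (by rw [abs_neg]; exact abs_im_div_mul_le him κ le_rfl) hη hη4

/-- [folklore] **`‖s♭_{M,κ}(m)(p)‖² ≤ 6·M²·sinWt M x_κ`** (`M ≤ N`). -/
theorem norm_sbMAl_sq_le_strip (him : ∀ i, |(p i).im| ≤ η) (hη : 0 ≤ η) (hη4 : η ≤ 1 / 4) {M : ℕ} (hMN : M ≤ N)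
    (m : TorusSite D N) (κ : Fin D) :
    ‖sbMAl N M p m κ‖ ^ 2 ≤ 6 * (M : ℝ) ^ 2 * sinWt M (kfine N (reVec p) m κ) := by
  unfold sbMAl
  rw [neg_kAl_eq, ← sinWt_neg]
  exact norm_gs_sq_le_of_im _ _ M (by rw [abs_neg]; exact abs_im_div_mul_le him κ hMN) hη hη4

/-- [folklore] Product form: if `‖f i‖² ≤ c·g i` for all `i` then `‖Π f i‖² ≤ c^D·Π g i`. -/
theorem norm_prod_sq_le {f : Fin D → ℂ} {g : Fin D → ℝ} {c : ℝ} (h : ∀ i, ‖f i‖ ^ 2 ≤ c * g i) :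
    ‖∏ i, f i‖ ^ 2 ≤ c ^ D * ∏ i, g i := by
  rw [norm_prod, ← Finset.prod_pow,
    show c ^ D = ∏ _i : Fin D, c by rw [Finset.prod_const, Finset.card_univ, Fintype.card_fin], ← Finset.prod_mul_distrib]
  exact Finset.prod_le_prod (fun i _ => by positivity) fun i _ => h i

/-- [folklore] **`‖S(m)(p)‖² ≤ (6N²)^D·Π_i sinWt N x_i`**. -/
theorem norm_SAl_sq_le_strip (him : ∀ i, |(p i).im| ≤ η) (hη : 0 ≤ η) (hη4 : η ≤ 1 / 4) (m : TorusSite D N) :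
    ‖SAl N p m‖ ^ 2 ≤ (6 * (N : ℝ) ^ 2) ^ D * ∏ i, sinWt N (kfine N (reVec p) m i) := by
  unfold SAl
  exact norm_prod_sq_le fun i => norm_sAl_sq_le_strip him hη hη4 m i

/-- [folklore] **`‖S♭(m)(p)‖² ≤ (6N²)^D·Π_i sinWt N x_i`**. -/
theorem norm_SbAl_sq_le_strip (him : ∀ i, |(p i).im| ≤ η) (hη : 0 ≤ η) (hη4 : η ≤ 1 / 4) (m : TorusSite D N) :
    ‖SbAl N p m‖ ^ 2 ≤ (6 * (N : ℝ) ^ 2) ^ D * ∏ i, sinWt N (kfine N (reVec p) m i) := by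
  unfold SbAl
  exact norm_prod_sq_le fun i => norm_sbAl_sq_le_strip him hη hη4 m i

/-- [folklore] **`‖S_M(m)(p)‖² ≤ (6M²)^D·Π_i sinWt M x_i`** (`M ≤ N`). -/
theorem norm_SMAl_sq_le_strip (him : ∀ i, |(p i).im| ≤ η) (hη : 0 ≤ η) (hη4 : η ≤ 1 / 4) {M : ℕ} (hMN : M ≤ N)
    (m : TorusSite D N) : ‖SMAl N M p m‖ ^ 2 ≤ (6 * (M : ℝ) ^ 2) ^ D * ∏ i, sinWt M (kfine N (reVec p) m i) := by
  unfold SMAl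
  exact norm_prod_sq_le fun i => norm_sMAl_sq_le_strip him hη hη4 hMN m i

/-- [folklore] **`‖S♭_M(m)(p)‖² ≤ (6M²)^D·Π_i sinWt M x_i`** (`M ≤ N`). -/
theorem norm_SbMAl_sq_le_strip (him : ∀ i, |(p i).im| ≤ η) (hη : 0 ≤ η) (hη4 : η ≤ 1 / 4) {M : ℕ} (hMN : M ≤ N)
    (m : TorusSite D N) : ‖SbMAl N M p m‖ ^ 2 ≤ (6 * (M : ℝ) ^ 2) ^ D * ∏ i, sinWt M (kfine N (reVec p) m i) := by
  unfold SbMAl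
  exact norm_prod_sq_le fun i => norm_sbMAl_sq_le_strip him hη hη4 hMN m i

/-- [folklore] **THE Q-ROW / LEG WEIGHT `S(m)·s_κ(m)` ON THE STRIP**: `‖S·s_κ‖² ≤ (6N²)^D·6N²·(Π_i sinWt N x_i)·sinWt N x_κ`. -/
theorem norm_SAl_mul_sAl_sq_le_strip (him : ∀ i, |(p i).im| ≤ η) (hη : 0 ≤ η) (hη4 : η ≤ 1 / 4) (m : TorusSite D N) (κ : Fin D) :
    ‖SAl N p m * sAl N p m κ‖ ^ 2
      ≤ (6 * (N : ℝ) ^ 2) ^ D * (6 * (N : ℝ) ^ 2) * ((∏ i, sinWt N (kfine N (reVec p) m i)) * sinWt N (kfine N (reVec p) m κ)) := by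
  rw [norm_mul, mul_pow]
  have h1 := norm_SAl_sq_le_strip him hη hη4 m
  have h2 := norm_sAl_sq_le_strip him hη hη4 m κ
  calc ‖SAl N p m‖ ^ 2 * ‖sAl N p m κ‖ ^ 2
      ≤ ((6 * (N : ℝ) ^ 2) ^ D * ∏ i, sinWt N (kfine N (reVec p) m i)) * (6 * (N : ℝ) ^ 2 * sinWt N (kfine N (reVec p) m κ)) :=
        mul_le_mul h1 h2 (by positivity) (mul_nonneg (by positivity) (Finset.prod_nonneg fun _ _ => (sinWt_pos _ _).le))
    _ = _ := by ring

/-- [folklore] **`‖χ̂(m)(p)‖² ≤ 6^D·Π_i sinWt N x_i ≤ 6^D`** (`χ̂ = S♭/N^D`). -/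
theorem norm_chiAl_sq_le_strip (him : ∀ i, |(p i).im| ≤ η) (hη : 0 ≤ η) (hη4 : η ≤ 1 / 4) (m : TorusSite D N) :
    ‖chiAl N p m‖ ^ 2 ≤ (6 : ℝ) ^ D * ∏ i, sinWt N (kfine N (reVec p) m i) := by
  have hN : (0 : ℝ) < N := by exact_mod_cast Nat.pos_of_ne_zero (NeZero.ne N)
  have h := norm_SbAl_sq_le_strip him hη hη4 m
  unfold chiAl
  rw [norm_div, norm_pow, Complex.norm_natCast, div_pow, div_le_iff₀ (by positivity)]
  calc ‖SbAl N p m‖ ^ 2 ≤ (6 * (N : ℝ) ^ 2) ^ D * ∏ i, sinWt N (kfine N (reVec p) m i) := h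
    _ = (6 : ℝ) ^ D * (∏ i, sinWt N (kfine N (reVec p) m i)) * ((N : ℝ) ^ D) ^ 2 := by rw [mul_pow]; ring

/-- [folklore] `‖χ̂(m)(p)‖² ≤ 6^D`. -/
theorem norm_chiAl_sq_le_six_pow (him : ∀ i, |(p i).im| ≤ η) (hη : 0 ≤ η) (hη4 : η ≤ 1 / 4) (m : TorusSite D N) :
    ‖chiAl N p m‖ ^ 2 ≤ (6 : ℝ) ^ D := by
  have h := norm_chiAl_sq_le_strip him hη hη4 m
  have hprod : ∏ i, sinWt N (kfine N (reVec p) m i) ≤ 1 :=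
    Finset.prod_le_one (fun i _ => (sinWt_pos _ _).le) fun i _ => sinWt_le_one _ _
  calc ‖chiAl N p m‖ ^ 2 ≤ (6 : ℝ) ^ D * ∏ i, sinWt N (kfine N (reVec p) m i) := h
    _ ≤ (6 : ℝ) ^ D * 1 := mul_le_mul_of_nonneg_left hprod (by positivity)
    _ = (6 : ℝ) ^ D := mul_one _

/-- [folklore] **THE OFFSET PHASE ON THE STRIP**: `‖e^{i k_m(p)·(Mρ)}‖ = exp(−(M/N)·Σ_i Im(p_i)·ρ_i)` — NOT unimodular off the real zone. -/
theorem norm_cexp_offset_eq (p : Fin D → ℂ) (m : TorusSite D N) (M : ℕ) (ρ : Fin D → ℤ) :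
    ‖cexp (I * ∑ i, kAl N p m i * ((M : ℂ) * (ρ i : ℂ)))‖ = Real.exp (-(∑ i, (p i).im / N * ((M : ℝ) * (ρ i : ℝ)))) := by
  rw [Complex.norm_exp]
  congr 1
  rw [Complex.mul_re, Complex.I_re, Complex.I_im, zero_mul, one_mul, zero_sub, Complex.im_sum]
  congr 1
  refine Finset.sum_congr rfl fun i _ => ?_
  have h := (kAl_re_im p m i)
  rw [Complex.mul_im, h.1, h.2]
  simp [Complex.mul_re, Complex.mul_im, Complex.natCast_re, Complex.natCast_im, Complex.intCast_re, Complex.intCast_im]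

/-- [folklore] Hence `‖e^{i k_m(p)·(Mρ)}‖ ≤ exp(η·Σ_i |ρ_i|)` on the strip, for every `M ≤ N` (the leg offsets are bounded, so this is an
`N`-free constant per leg; the growth in `ρ` is the one p1's centring `unitK_KInvStep_eq_offset` absorbs — never bound `kFibΔ` factorwise). -/
theorem norm_cexp_offset_le (him : ∀ i, |(p i).im| ≤ η) {M : ℕ} (hMN : M ≤ N) (m : TorusSite D N) (ρ : Fin D → ℤ) :
    ‖cexp (I * ∑ i, kAl N p m i * ((M : ℂ) * (ρ i : ℂ)))‖ ≤ Real.exp (η * ∑ i, |(ρ i : ℝ)|) := by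
  rw [norm_cexp_offset_eq, Finset.mul_sum]
  refine Real.exp_le_exp.2 ?_
  rw [← Finset.sum_neg_distrib]
  refine Finset.sum_le_sum fun i _ => ?_
  have h1 : |(p i).im / N * ((M : ℝ) * (ρ i : ℝ))| ≤ η * |(ρ i : ℝ)| := by
    rw [abs_mul, abs_mul, Nat.abs_cast, ← mul_assoc]
    exact mul_le_mul_of_nonneg_right (abs_im_div_mul_le him i hMN) (abs_nonneg _)
  have := neg_abs_le ((p i).im / N * ((M : ℝ) * (ρ i : ℝ)))
  linarith

/-- [folklore] The flat offset phase: `‖e^{−i k_m(p)·(Mρ)}‖ ≤ exp(η·Σ_i |ρ_i|)` likewise. -/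
theorem norm_cexp_neg_offset_le (him : ∀ i, |(p i).im| ≤ η) {M : ℕ} (hMN : M ≤ N) (m : TorusSite D N) (ρ : Fin D → ℤ) :
    ‖cexp (-(I * ∑ i, kAl N p m i * ((M : ℂ) * (ρ i : ℂ))))‖ ≤ Real.exp (η * ∑ i, |(ρ i : ℝ)|) := by
  have h := norm_cexp_offset_le him hMN m (fun i => -ρ i)
  have hsum : (∑ i, kAl N p m i * ((M : ℂ) * ((-ρ i : ℤ) : ℂ))) = -∑ i, kAl N p m i * ((M : ℂ) * (ρ i : ℂ)) := by
    rw [← Finset.sum_neg_distrib]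
    exact Finset.sum_congr rfl fun i _ => by push_cast; ring
  rw [hsum, mul_neg] at h
  have habs : (∑ i, |((-ρ i : ℤ) : ℝ)|) = ∑ i, |(ρ i : ℝ)| := Finset.sum_congr rfl fun i _ => by push_cast; rw [abs_neg]
  rwa [habs] at h

end Strip

end Summit.QuantumFields.BalabanUV.Beta.GAN24.StripAliasWeights

end
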